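import Mathlib
import Summits.NavierStokesRegularity.NavierStokesRegularity.Theorems.TaoLadderRungTwoBreakOneShiftWindowTermEncl
import Summits.NavierStokesRegularity.NavierStokesRegularity.Theorems.TaoLadderRungTwoBreakOneShiftT4W76Rows
import HarnessLib

/-!
# The one-shift instance T4 @ ε₀ = 1/10, W = 76: ITS TERM-DATA PRESENTATION (the instance bridge, concrete part) — the
# `TermPresD 4` of part XLVII for the frame `T4W76.frame bd`: numbering `(i, j) ↦ i + 4j`, the exact rational / `Λ`-power
# presentation of the circuit table T4 = `circuitTable 1 0.326 0.134 0.375 (Λ·0.618)`, its per-mode support lists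
# (computed by filtering the nonzero rational parts), `ε₀ = 1/10`, certified boxes of `Λ = 1.1^{5/2}` and `Λ⁻¹` at
# `2⁻⁶²`, and tube centre boxes / radius bounds (the wake centre boxes of shell `−1` are the only box-data dependent input),
# with the proofs of `TermPresD.Frames` and `check = true` — so `hRDc` / `hRD` / `hTf` of parts XLVI / L `K1_of_grid(C)` are
# discharged for THIS row once the emitter's steps carry `RD := (presT4 cb).mkRD` (cell harvest/h2-tao-ladder, seat p2;
# rung1/KERNEL-CHEAP-REPLAY-SPEC.md §9 (I); support for K1(1) = `NoSurvivingDSSOne`, stmt-NavierStokesRegularity-20205)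

MODEL lattice only (comparable circuit table T4, scale ratio `11/10`); nothing here is a statement about the
Navier–Stokes equations; no item is closed; nothing numerical about the certificate is asserted.
-/

noncomputable section

-- the sub-problem namespace repeats the summit name by design (D-0017)
set_option linter.dupNamespace false

namespace Summit.NavierStokesRegularity.NavierStokesRegularity.Theorems

namespace DSSOneShift

open Set Finset
open Literature.Analysis.FluidPDE Literature.Analysis.FluidPDE.TaoCascade
open Summit.NavierStokesRegularity.NavierStokesRegularity.Theorems.TaylorModelCert
open Summit.NavierStokesRegularity.NavierStokesRegularity.Theorems.CertificateGlueOn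

namespace T4W76

/-! ### The exact presentation of the table -/

/-- The RATIONAL PART of the circuit table T4 (`k = Λ · 0.618` contributes `0.618` resp. `−0.309` with `Λ`-power `1`).
[cite: Tao2016AveragedNS, §4 (4.1)–(4.3), §5; cell vocabulary, module …CircuitTableDefs (`circuitTable`)] -/
def qT4 (i₁ i₂ i₃ : Fin 4) (μ : ShiftIdx) : ℚ :=
  if μ.1 = (0, 0, 0) then
    (if (i₁ = 2 ∧ i₂ = 3 ∧ i₃ = 0) ∨ (i₁ = 3 ∧ i₂ = 2 ∧ i₃ = 0) then -1 / 2
      else if (i₁ = 0 ∧ i₂ = 1 ∧ i₃ = 0) ∨ (i₁ = 1 ∧ i₂ = 0 ∧ i₃ = 0) then -(326 / 1000) / 2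
      else if (i₁ = 0 ∧ i₂ = 2 ∧ i₃ = 0) ∨ (i₁ = 2 ∧ i₂ = 0 ∧ i₃ = 0) then -(134 / 1000) / 2
      else if i₁ = 0 ∧ i₂ = 0 ∧ i₃ = 1 then 326 / 1000
      else if i₁ = 2 ∧ i₂ = 2 ∧ i₃ = 1 then -(375 / 1000)
      else if i₁ = 0 ∧ i₂ = 0 ∧ i₃ = 2 then 134 / 1000
      else if (i₁ = 1 ∧ i₂ = 2 ∧ i₃ = 2) ∨ (i₁ = 2 ∧ i₂ = 1 ∧ i₃ = 2) then (375 / 1000) / 2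
      else if (i₁ = 2 ∧ i₂ = 0 ∧ i₃ = 3) ∨ (i₁ = 0 ∧ i₂ = 2 ∧ i₃ = 3) then 1 / 2
      else 0)
  else if μ.1 = (0, 0, 1) then (if i₁ = 3 ∧ i₂ = 3 ∧ i₃ = 0 then 618 / 1000 else 0)
  else if μ.1 = (0, 1, 0) then (if i₁ = 3 ∧ i₂ = 0 ∧ i₃ = 3 then -(618 / 1000) / 2 else 0)
  else if μ.1 = (1, 0, 0) then (if i₁ = 0 ∧ i₂ = 3 ∧ i₃ = 3 then -(618 / 1000) / 2 else 0)
  else 0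

/-- The `Λ`-exponent of the table entries: `1` on the three inter-shell shifts, `0` intra-shell. [folklore] -/
def aT4 (_i₁ _i₂ _i₃ : Fin 4) (μ : ShiftIdx) : ℤ := if μ.1 = (0, 0, 0) then 0 else 1

/-- **The table is its rational part times `Λ^a`.** [cite: Tao2016AveragedNS, §4 (4.1); cell vocabulary, module …T4W76Defs (`αT4`)] -/
theorem αT4_pres (i₁ i₂ i₃ : Fin 4) (μ : ShiftIdx) :
    αT4 i₁ i₂ i₃ μ = (qT4 i₁ i₂ i₃ μ : ℝ) * bigLam (1 / 10) ^ aT4 i₁ i₂ i₃ μ := by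
  simp only [αT4, circuitTable, qT4, aT4]
  split_ifs <;> · simp only [zpow_zero, zpow_one]; push_cast; ring

/-! ### Support lists -/

/-- Tao's four shifts as a list of the index type. [cite: Tao2016AveragedNS, §4 after (4.1)] -/
def shiftList : List ShiftIdx :=
  [⟨(0, 0, 0), by simp [mem_shiftSet_iff]⟩, ⟨(1, 0, 0), by simp [mem_shiftSet_iff]⟩,
    ⟨(0, 1, 0), by simp [mem_shiftSet_iff]⟩, ⟨(0, 0, 1), by simp [mem_shiftSet_iff]⟩]

/-- Every shift is listed. [folklore] -/
theorem mem_shiftList (μ : ShiftIdx) : μ ∈ shiftList := by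
  obtain ⟨μ, hμ⟩ := μ
  have h := (mem_shiftSet_iff μ).1 (by simpa using hμ)
  rcases h with rfl | rfl | rfl | rfl <;> simp [shiftList]

/-- All `(i₁, i₂, μ)`. [folklore] -/
def univT : List (Fin 4 × Fin 4 × ShiftIdx) := (List.finRange 4) ×ˢ ((List.finRange 4) ×ˢ shiftList)

/-- Every triple is listed. [folklore] -/
theorem mem_univT (q : Fin 4 × Fin 4 × ShiftIdx) : q ∈ univT := by
  rcases q with ⟨i₁, i₂, μ⟩
  simp only [univT, List.mem_product, List.mem_finRange, true_and]
  exact mem_shiftList μ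

/-- `univT` has no duplicates. [folklore] -/
theorem nodup_univT : univT.Nodup :=
  (List.nodup_finRange 4).product ((List.nodup_finRange 4).product (by decide))

/-- **The support list of output mode `i`**: the triples with a nonzero rational part. [folklore] -/
def suppT4 (i : Fin 4) : List (Fin 4 × Fin 4 × ShiftIdx) := univT.filter fun q => decide (qT4 q.1 q.2.1 i q.2.2 ≠ 0)

/-- Off the support list the rational part vanishes. [folklore] -/
theorem qT4_eq_zero_of_not_mem {i i₁ i₂ : Fin 4} {μ : ShiftIdx} (h : (i₁, i₂, μ) ∉ suppT4 i) : qT4 i₁ i₂ i μ = 0 := by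
  by_contra hne
  exact h (List.mem_filter.2 ⟨mem_univT _, by simpa using hne⟩)

/-! ### Numbering, scalar boxes, tubes -/

/-- The flat numbering `(i, j) ↦ i + 4 j` of the window coordinates. [folklore] -/
def eT4 (bd : BoxData) : (frame bd).SIdx ≃ Fin 304 :=
  ((Equiv.prodComm (Fin 4) (Fin 76)).trans finProdFinEquiv).trans (finCongr (by norm_num))

/-- Its values. [folklore] -/
theorem eT4_val (bd : BoxData) (i : Fin 4) (j : Fin 76) : ((eT4 bd (i, j) : Fin 304) : ℕ) = (i : ℕ) + 4 * j := rfl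

/-- Tube centre boxes: the given boxes `cb i` on the wake shell `−1`, crude dyadic boxes `[−2^{|k|}, 2^{|k|}]` on the deeper
wake (never read by a term), `[0, 0]` on the top. [cite: Tao2016AveragedNS, §4; cell vocabulary, module …T4W76Defs (`tubeCT4`)] -/
def cenT4 (cb : Fin 4 → IntervalD) (i : Fin 4) (k : ℤ) : IntervalD :=
  if k = -1 then cb i else if k < 0 then ⟨⟨-1, -k⟩, ⟨1, -k⟩⟩ else IntervalD.ofInt 0

/-- Tube radius bounds: `⌈g_hi (r₀ + κ) · 2⁶⁰⌉ 2⁻⁶⁰` on shell `−1`, `4^{|k|}` on the deeper wake, `⌈10⁻³⁰ 2¹⁶⁰⌉ 2⁻¹⁶⁰` on the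
top. [cite: Tao2016AveragedNS, §4; cell vocabulary, module …T4W76Defs (`tubeRT4`)] -/
def radT4 (k : ℤ) : Dyad :=
  if k = -1 then ⟨197142128377967, -60⟩ else if k < 0 then ⟨1, -2 * k⟩ else ⟨1461501637330902919, -160⟩

/-- **THE TERM-DATA PRESENTATION OF T4 @ 1/10, W = 76.** [cite: Tao2016AveragedNS, §4 (4.1), (4.8); cell vocabulary, harvest/h2-tao-ladder rung1/KERNEL-CHEAP-REPLAY-SPEC.md §9 (I)] -/
def presT4 (cb : Fin 4 → IntervalD) : TermPresD 4 where
  prec := 64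
  W := 76
  n := 304
  eN i j := (i : ℕ) + 4 * j
  dN c := (c % 4, c / 4)
  supp := suppT4
  qcoef := qT4
  apow := aT4
  epsQ := 1 / 10
  lam := ⟨⟨5852500292342157397, -62⟩, ⟨5852500292342157398, -62⟩⟩
  lamInv := ⟨⟨3633942224725184815, -62⟩, ⟨3633942224725184816, -62⟩⟩
  cen := cenT4 cb
  rad := radT4

/-- The square certificates of the `Λ` / `Λ⁻¹` boxes evaluate to `true`. [folklore] -/
theorem check_presT4 (cb : Fin 4 → IntervalD) : (presT4 cb).check = true := by
  have h : (presT4 cb).check = (presT4 fun _ => IntervalD.ofInt 0).check := rfl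
  rw [h]
  unfold TermPresD.check presT4
  simp only [Dyad.toRat, decide_eq_true_eq]
  norm_num

/-! ### The tube facts -/

/-- Powers of numbers in `[0, 2]` are below powers of `2`. [folklore] -/
theorem pow_le_two_pow {x : ℝ} (h0 : 0 ≤ x) (h2 : x ≤ 2) (n : ℕ) : x ^ n ≤ 2 ^ n := pow_le_pow_left₀ h0 h2 n

/-- Wake centres lie in the crude boxes: `|ĝ^n ŷ_{i,0}| ≤ 2^n`. [folklore] -/
theorem abs_wakeC_le (bd : BoxData) (i : Fin 4) (n : ℕ) : |ghat ^ n * bd.yc i 0| ≤ (2 : ℝ) ^ n := by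
  have hc := bd.yc_le i
  have hg : ghat ^ n ≤ 2 ^ n := pow_le_two_pow (by unfold ghat; norm_num) (by unfold ghat; norm_num) n
  have hg0 : 0 ≤ ghat ^ n := by unfold ghat; positivity
  rw [abs_mul, abs_of_nonneg hg0]
  unfold cmax at hc
  calc ghat ^ n * |bd.yc i 0| ≤ 2 ^ n * 1 := mul_le_mul hg (by linarith) (abs_nonneg _) (by positivity)
    _ = 2 ^ n := mul_one _

/-- Deeper wake radii are below `4^n`: `g_hi^n (r₀ + κ n) ≤ 4^n`. [folklore] -/
theorem wakeR_le (n : ℕ) : gHi ^ n * (r₀ + κw * (n : ℝ)) ≤ (4 : ℝ) ^ n := by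
  have hg : gHi ^ n ≤ 2 ^ n := pow_le_two_pow (by unfold gHi; norm_num) (by unfold gHi; norm_num) n
  have hg0 : 0 ≤ gHi ^ n := by unfold gHi; positivity
  have hn : (n : ℝ) ≤ 2 ^ n := by exact_mod_cast Nat.lt_two_pow_self.le
  have h1 : (1 : ℝ) ≤ 2 ^ n := one_le_pow₀ (by norm_num)
  have hr : r₀ + κw * (n : ℝ) ≤ 2 ^ n := by unfold r₀ κw; nlinarith
  have hr0 : 0 ≤ r₀ + κw * (n : ℝ) := by unfold r₀ κw; positivity
  calc gHi ^ n * (r₀ + κw * (n : ℝ)) ≤ 2 ^ n * 2 ^ n := mul_le_mul hg hr hr0 (by positivity)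
    _ = 4 ^ n := by rw [← mul_pow]; norm_num

/-- **The presentation matches the frame of the row** (given boxes `cb i ∋ ĝ ŷ_{i,0}` of the wake centres at shell `−1`).
[cite: Tao2016AveragedNS, §4 (4.1), (4.8); cell vocabulary, harvest/h2-tao-ladder rung1/KERNEL-CHEAP-REPLAY-SPEC.md §9 (I)] -/
theorem frames_presT4 (bd : BoxData) (cb : Fin 4 → IntervalD) (hcb : ∀ i, IntervalD.mem (ghat * bd.yc i 0) (cb i)) :
    (presT4 cb).Frames (frame bd) (1 / 10) αT4 (eT4 bd) where
  hW := rfl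
  heN i j := eT4_val bd i j
  hdN i j := by
    have hi := i.isLt
    show (((i : ℕ) + 4 * j) % 4, ((i : ℕ) + 4 * j) / 4) = ((i : ℕ), (j : ℕ))
    ext
    · simp only; omega
    · simp only; omega
  hε := by simp [presT4]
  hα i₁ i₂ i μ := αT4_pres i₁ i₂ i μ
  hsupp i i₁ i₂ μ h := by
    rw [αT4_pres, show (presT4 cb).supp = suppT4 from rfl] at *
    rw [qT4_eq_zero_of_not_mem h]; simp
  hnodup i := by
    show (suppT4 i).Nodup
    exact nodup_univT.filter _
  hcen i k hk := by
    show IntervalD.mem ((frame bd).tubeC i k) (cenT4 cb i k)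
    rw [frame_tubeC]
    unfold cenT4 tubeCT4
    by_cases hk1 : k = -1
    · subst hk1
      simp only [if_true, show (-1 : ℤ) < 0 by norm_num]
      simpa using hcb i
    · rw [if_neg hk1]
      by_cases hk0 : k < 0
      · rw [if_pos hk0, if_pos hk0]
        have hn : ((-k).toNat : ℤ) = -k := by omega
        have h := abs_wakeC_le bd i (-k).toNat
        rw [abs_le] at h
        have e2 : (2 : ℝ) ^ (-k).toNat = (2 : ℝ) ^ (-k) := by rw [← zpow_natCast, hn]
        rw [e2] at h
        simp only [IntervalD.mem, Dyad.toReal, Int.cast_neg, Int.cast_one, neg_mul, one_mul]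
        exact ⟨h.1, h.2⟩
      · rw [if_neg hk0, if_neg hk0]
        exact_mod_cast IntervalD.mem_ofInt 0
  hrad k hk := by
    show (frame bd).tubeR k ≤ (radT4 k).toReal
    rw [frame_tubeR]
    have hk' : ¬ (0 ≤ k ∧ k < 76) := hk
    unfold radT4 tubeRT4
    by_cases hk1 : k = -1
    · subst hk1
      simp only [if_true, show (-1 : ℤ) < 0 by norm_num]
      simp only [Dyad.toReal]
      unfold gHi r₀ κw
      norm_num
    · rw [if_neg hk1]
      by_cases hk0 : k < 0
      · rw [if_pos hk0, if_pos hk0]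
        have hn : ((-k).toNat : ℤ) = -k := by omega
        have h := wakeR_le (-k).toNat
        have e4 : (4 : ℝ) ^ (-k).toNat = (2 : ℝ) ^ (-2 * k) := by
          rw [show (4 : ℝ) = 2 ^ (2 : ℤ) by norm_num, ← zpow_natCast, ← zpow_mul, hn]; ring_nf
        simp only [Dyad.toReal, Int.cast_one, one_mul]
        rw [← e4]
        exact h
      · have hk76 : 76 ≤ k := by omega
        rw [if_neg hk0, if_neg hk0, if_pos hk76]
        simp only [Dyad.toReal]
        have hhalf : ((1 : ℝ) / 2) ^ (k - 76).toNat ≤ 1 := pow_le_one₀ (by norm_num) (by norm_num)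
        unfold εR
        have : (1 : ℝ) / 10 ^ 30 * (1 / 2) ^ (k - 76).toNat ≤ 1 / 10 ^ 30 := by
          have h0 : (0 : ℝ) ≤ 1 / 10 ^ 30 := by positivity
          nlinarith
        refine this.trans ?_
        norm_num

/-- **The term-data hypotheses of `K1_of_grid(C)` for this row**, for any grid whose steps all carry `RD := (presT4 cb).mkRD`:
`hRDc`, `hRD` (every admissible realisation, every step, every time) and `hTf`. [cite: Tao2016AveragedNS, §4 (4.8); cell vocabulary, harvest/h2-tao-ladder rung1/KERNEL-CHEAP-REPLAY-SPEC.md §9 (I)] -/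
theorem termData_presT4 (bd : BoxData) (cb : Fin 4 → IntervalD) (hcb : ∀ i, IntervalD.mem (ghat * bd.yc i 0) (cb i))
    {g : GridD} (hgn : g.n = 304) (hn : ∀ s, (g.step s).n = g.n) (hRD : ∀ s ≤ g.S, (g.step s).RD = (presT4 cb).mkRD)
    (R : ℤ → ℝ) :
    (∀ s ≤ g.S, IsRTEncl (g.es ((eT4 bd).trans (finCongr hgn.symm)) hn s)
      (TermPresD.centreList (frame bd) (1 / 10) αT4) (TermPresD.centreList (frame bd) (1 / 10) αT4)
      ((presT4 cb).rowsOf (frame bd)) (g.step s).RD) ∧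
    (∀ u, (frame bd).AdmLip R u → ∀ s ≤ g.S, ∀ r ∈ Ico 0 (g.h s).toReal,
      IsRTEncl (g.es ((eT4 bd).trans (finCongr hgn.symm)) hn s) (TermPresD.centreList (frame bd) (1 / 10) αT4)
        ((frame bd).wterms (1 / 10) αT4 ((frame bd).preclampTail u) (g.t s + r)) ((presT4 cb).rowsOf (frame bd))
        (g.step s).RD) ∧
    (∀ u, (frame bd).AdmLip R u → ∀ t x,
      termField ((frame bd).wterms (1 / 10) αT4 ((frame bd).preclampTail u) t) x =
        (frame bd).wfieldFlat (1 / 10) αT4 ((frame bd).preclampTail u) t x) := by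
  have hPn : (presT4 cb).n = g.n := by rw [hgn]; rfl
  have S := frames_presT4 bd cb hcb
  have S' : (presT4 cb).Frames (frame bd) (1 / 10) αT4 (((eT4 bd).trans (finCongr hgn.symm)).trans (finCongr hPn.symm)) :=
    { S with heN := fun i j => S.heN i j }
  exact ⟨TermPresD.hRDc_of_frames hn hPn S' (check_presT4 cb) hRD,
    TermPresD.hRD_of_frames hn hPn S' (check_presT4 cb) hRD R, TermPresD.hTf_wterms R⟩

end T4W76

end DSSOneShift

end Summit.NavierStokesRegularity.NavierStokesRegularity.Theorems
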